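import Literature.NumberTheory.EllipticCurves.CuspFormTwistGamma1
import Literature.NumberTheory.EllipticCurves.NewformsLevelEqOfHeckeEigenvalueEqProofs
import Literature.NumberTheory.EllipticCurves.NewformsLiftProofs
import Literature.NumberTheory.EllipticCurves.NewformsMainLemmaProofs
import Literature.NumberTheory.EllipticCurves.NewformsHeckeProofs
import Literature.NumberTheory.EllipticCurves.NewformsProofs
import Literature.NumberTheory.EllipticCurves.CuspFormLFunction
import Literature.NumberTheory.EllipticCurves.SzpiroLocalDataProofs
import Literature.NumberTheory.Automorphic.BCDTQuadraticTwistCharacters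
import Summits.BirchSwinnertonDyer.Rank1Residual.Additive.PotSupersingularClasses
import Summits.BirchSwinnertonDyer.Rank1Residual.Additive.KodairaDictionaryThree
import Summits.BirchSwinnertonDyer.Rank1Residual.Additive.KodairaCondExpThree
import Summits.BirchSwinnertonDyer.Rank1Residual.Additive.UnramifiedBaseChange
import HarnessLib

/-!
# Wild inertia at `3` on `ClassO6` rows, modular-forms half: the quadratic untwist of a newform with
# `27 ∣ N` keeps `3` in the level (print layer (T) of crux child C1, binder `hwild` of the K1 lead)

Cell `pub/bsd-wall` (D-0145 line `route-BirchSwinnertonDyer-CyclotomicUntwist`), seat `bsd-line-cycu-p3`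
(gen 10). THEOREMS ONLY (no definition, no named fact, no `sorry`); helper toward the crux child
C1 = stmt-BirchSwinnertonDyer-27548 (`PSUntwistedLFunctionAtThree`) through the K1 lead's print layer (T)
(ROOT LAW «`a₃(g₀)` is a root of `X² − a_w(W)X + 3`», files `CyclotomicUntwistCoinvariantEigenvalue`,
`CyclotomicUntwistInertiaOverCyclotomicNine` of cycu-p1 g8), whose Galois binder

  `hwild : ∃ v 𝔓, 𝔓 ∈ v.primesAbove ∧ (3 : 𝓞 ℚ) ∈ v.asIdeal ∧ ∃ i ∈ 𝔓.inertia Γ_ℚ, ρ_{W,2}(i)³ = 1 ∧ ρ_{W,2}(i) ≠ 1`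

(«the `2`-adic inertia image at `3` is WILD on a `ClassO6` row») is discharged in the companion file
`CyclotomicUntwistInertiaWildAtThree` from Carayol's Euler factors and THIS file. BSD is not proved by this
file; no crux and no child of the route is proved by it.

WHAT (pure newform theory + the conductor at `3`, all over tree theorems):

* §1 `exists_isNewform1_twist_changeLevel` — the tree's `exists_isNewform1_twist` (Shimura Prop. 3.64 /
  Atkin–Lehner–Li: the newform `g₀` behind the twist of a `Γ₁(N)`-newform `g` by a primitive `χ` mod `m`,
  level `N₀ ∣ N m²`, `a_p(g₀) = χ(p)a_p(g)` for `p ∤ N m`) with the nebentypus identity kept at the level of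
  CHARACTERS (`ε_{g₀}` and `ε_g χ²` induce the same character mod `N m²`), not only at primes — needed to
  recognise trivial nebentypus, i.e. to descend to `Γ₀`.
* §2 `three_dvd_level_of_psiThree_packet` — **if `f` is a newform on `Γ₀(N)` with `27 ∣ N` and `g₀` a
  newform on `Γ₁(N₀)` with TRIVIAL nebentypus whose prime coefficients are `ψ₃(p)·a_p(f)` off a finite set
  (`ψ₃ = (·/3)`, tree `BCDT.psiThree`), then `3 ∣ N₀`**: twisting `g₀` once more by `ψ₃` gives a newform of
  level dividing `9N₀` with trivial nebentypus and the prime packet of `f` off a finite set, which is `f` by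
  strong multiplicity one across levels on `Γ₀` (tree `IsNewform0.level_eq_of_heckeEigenvalue_eq_holds`),
  so `N ∣ 9N₀`, and `27 ∣ N` forces `3 ∣ N₀`.
* §3 `pow_three_dvd_conductorNorm_of_classO6` — on a `ClassO6` row `27 ∣ N_W` (`f₃ ≥ 3`: wild Kodaira type,
  tree `three_le_condExp_three_of_kodairaSymbolAt_wild`, `factorization_conductorNorm_primesEquiv_symm`);
  `lFunction_three_eq_zero_of_classO6` — `a₃(W) = 0` (additive reduction).
* §4 packets for the engine `map_reverse_charpoly_toInertiaCoinvariants_twist_eq`: the lift of `f_W` to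
  `Γ₁(N)` (`cuspCoeff_liftToGamma1_eq_lFunction`, `nebentypus_liftToGamma1_apply_three`) and the newform
  of its `ψ₃`-twist (`exists_psiThree_twist_newform`: trivial nebentypus, level `∣ 9N`, packet
  `ψ₃(p)a_p(W)`), with `ε(3) ≠ 0 ⟹ 3 ∤ level` (`not_three_dvd_of_nebentypus_one_apply_ne_zero`).

References: [cite: Shimura1971, Prop. 3.64] · [cite: DiamondShurman2005, Thm. 5.8.2–5.8.3] ·
[cite: AtkinLehner1970, Thm. 4] · [cite: SilvermanATAEC1994, IV.10.4 and Table 4.1] ·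
[cite: SilvermanAEC2009, §C.16].
-/

set_option autoImplicit false
-- single-conjunct summit: `Summit.BirchSwinnertonDyer.BirchSwinnertonDyer.…` repeats the name by design
set_option linter.dupNamespace false

noncomputable section

open scoped MatrixGroups ModularForm NumberField
open CongruenceSubgroup IsDedekindDomain NumberField
  Literature.NumberTheory.EllipticCurves Literature.NumberTheory.EllipticCurves.ModularForms
  Literature.NumberTheory.Automorphic.BCDT
  Summit.BirchSwinnertonDyer.Rank1Residual.Additive

namespace Summit.BirchSwinnertonDyer.BirchSwinnertonDyer.Theorems.InertiaWildAtThreeLevel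

/-! ### §1 The newform of a twist, with the nebentypus identity as characters -/

/-- **The newform of a twist, nebentypus as a character** (Shimura 1971, Prop. 3.64 with Atkin–Lehner–Li
theory; Diamond–Shurman Thm. 5.8.2–5.8.3): for a newform `g ∈ S_k(Γ₁(N))` and a primitive Dirichlet
character `χ` mod `m` there is a newform `g₀` of level `N₀ ∣ N m²` with `a_p(g₀) = χ(p) a_p(g)` for every prime
`p ∤ N m`, and whose nebentypus induces, modulo `N m²`, the same character as `ε_g · χ²`. The tree's
`exists_isNewform1_twist` records the last clause only at primes; the proof is the same (the twist is an
eigenvector of the `T_p`, `p ∤ N m²`, in the `ε_g χ²`-eigenspace of the diamond operators, and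
`exists_isNewform1_of_eigenpacket` returns the character). [cite: Shimura1971, Prop. 3.64]
[cite: DiamondShurman2005, Thm. 5.8.2–5.8.3] -/
theorem exists_isNewform1_twist_changeLevel {N : ℕ} [NeZero N] {k : ℤ} {m : ℕ} [NeZero m]
    {g : CuspForm (Gamma1 N) k} (hg : IsNewform1 g) {χ : DirichletCharacter ℂ m} (hχ : χ.IsPrimitive) :
    ∃ (N₀ : ℕ) (_ : NeZero N₀) (hN₀ : N₀ ∣ N * m ^ 2) (g₀ : CuspForm (Gamma1 N₀) k), IsNewform1 g₀ ∧
      (∀ p : ℕ, p.Prime → ¬ p ∣ N * m → cuspCoeff g₀ p = χ p * cuspCoeff g p) ∧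
      DirichletCharacter.changeLevel hN₀ (nebentypus g₀) =
        DirichletCharacter.changeLevel (dvd_mul_right N (m ^ 2)) (nebentypus g) *
          DirichletCharacter.changeLevel ((Dvd.intro_left _ (sq m).symm).trans (dvd_mul_left (m ^ 2) N)) χ ^ 2 := by
  haveI : NeZero (N * m ^ 2) := ⟨mul_ne_zero (NeZero.ne N) (pow_ne_zero 2 (NeZero.ne m))⟩
  have hN : N ∣ N * m ^ 2 := dvd_mul_right N _
  have hm : m ^ 2 ∣ N * m ^ 2 := dvd_mul_left _ N
  have hNm : N * m ∣ N * m ^ 2 := mul_dvd_mul_left N (Dvd.intro_left _ (sq m).symm)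
  have hmL : m ∣ N * m ^ 2 := (Dvd.intro_left _ (sq m).symm).trans hm
  have hgε := IsNewform1.mem_nebentypusSubspace_nebentypus_holds hg
  set h := twistRaw1 (N * m ^ 2) hN hm hNm hgε χ with hh
  have hh0 : h ≠ 0 := twistRaw1_ne_zero _ hN hm hNm hgε hχ (by
    rw [(isNormalized_iff_cuspCoeff_one g).1 hg.2.2.2]; exact one_ne_zero)
  have hmem := twistRaw1_mem_nebentypusSubspace (N * m ^ 2) hN hm hNm hmL hgε χ
  have hT : ∀ (p : ℕ) (hp : p.Prime), ¬ p ∣ N * m ^ 2 →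
      (haveI : NeZero p := ⟨hp.ne_zero⟩; heckeT (Gamma1 (N * m ^ 2)) k p h) = (χ p * cuspCoeff g p) • h := by
    intro p hp hpL
    haveI : NeZero p := ⟨hp.ne_zero⟩
    exact heckeT_twistRaw1 _ hN hm hNm hgε hχ hp hpL (hg.heckeT_apply_eq_cuspCoeff_smul p hp)
  obtain ⟨N₀, _, hN₀, g₀, hnew, hcoeff, hchar⟩ := exists_isNewform1_of_eigenpacket hh0 hmem hT
  refine ⟨N₀, inferInstance, hN₀, g₀, hnew, fun p hp hpNm => ?_, hchar⟩
  have hpL : ¬ p ∣ N * m ^ 2 := by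
    intro h'
    rcases (Nat.Prime.dvd_mul hp).1 h' with h'' | h''
    · exact hpNm (h''.trans (dvd_mul_right N m))
    · exact hpNm ((Nat.Prime.dvd_of_dvd_pow hp h'').trans (dvd_mul_left m N))
  exact hcoeff p hp hpL

/-! ### §2 The quadratic untwist keeps `3` in the level when `27 ∣ N` -/

/-- `ψ₃(p)² = 1` for a prime `p ≠ 3` (`ψ₃` is quadratic and `p` is a unit mod `3`). [folklore] -/
theorem psiThree_sq_natCast {p : ℕ} (hp : p.Prime) (hp3 : p ≠ 3) :
    psiThree (p : ZMod 3) * psiThree (p : ZMod 3) = 1 := by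
  have hunit : IsUnit ((p : ℕ) : ZMod 3) :=
    (ZMod.isUnit_prime_iff_not_dvd hp).mpr fun h ↦ hp3 ((Nat.prime_dvd_prime_iff_eq hp Nat.prime_three).mp h)
  rcases psiThree_isQuadratic (p : ZMod 3) with h | h | h
  · exact absurd h (hunit.map psiThree).ne_zero
  · rw [h, mul_one]
  · rw [h]; norm_num

/-- A `Γ₁(M)`-newform with trivial nebentypus is the lift of a `Γ₀(M)`-newform (Diamond–Shurman §5.2,
`S_k(Γ₀(M)) = S_k(M, 𝟙)`, with Thm. 5.8.2; tree `exists_liftToGamma1_eq_of_forall_diamondOp_eq`,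
`isNewform1_liftToGamma1_iff_holds`). [cite: DiamondShurman2005, §5.2 and Thm. 5.8.2] -/
theorem exists_liftToGamma1_eq_of_nebentypus_eq_one {M : ℕ} [NeZero M] {k : ℤ}
    {g : CuspForm (Gamma1 M) k} (hg : IsNewform1 g) (hε : nebentypus g = 1) :
    ∃ g' : CuspForm (Gamma0 M) k, IsNewform0 g' ∧ liftToGamma1 M k g' = g := by
  have hmem := IsNewform1.mem_nebentypusSubspace_nebentypus_holds hg
  rw [hε, mem_nebentypusSubspace_iff_diamondOp] at hmem
  obtain ⟨g', hg'⟩ := exists_liftToGamma1_eq_of_forall_diamondOp_eq (k := k) (G := g) fun d hd ↦ by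
    obtain ⟨u, rfl⟩ := hd
    rw [hmem u, MulChar.one_apply u.isUnit, one_smul]
  refine ⟨g', ?_, hg'⟩
  rw [← isNewform1_liftToGamma1_iff_holds (N := M) (k := k) g', hg']
  exact hg

/-- For a normalised Hecke eigenform on `Γ₀(N)` the Hecke eigenvalue at a prime is the Fourier
coefficient (Diamond–Shurman Prop. 5.8.5). [cite: DiamondShurman2005, Prop. 5.8.5] -/
theorem heckeEigenvalue_eq_cuspCoeff_of_isNewform0 {N : ℕ} [NeZero N] {k : ℤ}
    {f : CuspForm (Gamma0 N) k} (hf : IsNewform0 f) {p : ℕ} (hp : p.Prime) :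
    heckeEigenvalue f p = cuspCoeff f p :=
  heckeEigenvalue_eq_coeff_of_isNormalized hf.2.2 hp (hf.2.1 p hp)

/-- **The quadratic untwist keeps `3` in the level.** Let `f ∈ S₂(Γ₀(N))` be a newform with `27 ∣ N`, and
`g₀ ∈ S₂(Γ₁(N₀))` a newform with TRIVIAL nebentypus whose prime coefficients off a finite set are
`ψ₃(p)·a_p(f)`, `ψ₃ = (·/3)`. Then `3 ∣ N₀`. Proof: the newform `g₁` of `g₀ ⊗ ψ₃` (§1) has level `N₁ ∣ 9N₀`,
trivial nebentypus (`ε_{g₀}ψ₃² = 1`), hence is the lift of a `Γ₀(N₁)`-newform with the prime packet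
`ψ₃(p)²a_p(f) = a_p(f)` off a finite set; by strong multiplicity one across levels (Atkin–Lehner 1970
Thm. 4, tree `IsNewform0.level_eq_of_heckeEigenvalue_eq_holds`) `N = N₁ ∣ 9N₀`, and `27 ∣ N`.
[cite: AtkinLehner1970, Thm. 4] [cite: DiamondShurman2005, Thm. 5.8.2–5.8.3] -/
theorem three_dvd_level_of_psiThree_packet {N : ℕ} [NeZero N] {f : CuspForm (Gamma0 N) 2}
    (hf : IsNewform0 f) (h27 : 27 ∣ N) {N₀ : ℕ} [NeZero N₀] {g₀ : CuspForm (Gamma1 N₀) 2}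
    (hg₀ : IsNewform1 g₀) (hε : nebentypus g₀ = 1) {T₀ : ℕ} (hT₀ : T₀ ≠ 0)
    (hpk : ∀ p : ℕ, p.Prime → ¬ p ∣ T₀ → cuspCoeff g₀ p = psiThree (p : ZMod 3) * cuspCoeff f p) :
    3 ∣ N₀ := by
  classical
  haveI : NeZero (3 : ℕ) := ⟨by norm_num⟩
  obtain ⟨N₁, _, hN₁, g₁, hg₁, hcoef, hchar⟩ :=
    exists_isNewform1_twist_changeLevel hg₀ psiThree_isPrimitive
  -- `g₁` has trivial nebentypus
  have hε₁ : nebentypus g₁ = 1 := by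
    apply DirichletCharacter.changeLevel_injective hN₁
    rw [hchar, hε, DirichletCharacter.changeLevel_one, DirichletCharacter.changeLevel_one, one_mul,
      ← map_pow, psiThree_isQuadratic.sq_eq_one, DirichletCharacter.changeLevel_one]
  obtain ⟨g₁', hg₁', hlift⟩ := exists_liftToGamma1_eq_of_nebentypus_eq_one hg₁ hε₁
  -- the prime packet of `g₁'` is that of `f` off `3 N₀ T₀`
  have hpacket : ∀ p : ℕ, p.Prime → ¬ p ∣ 3 * N₀ * T₀ → cuspCoeff g₁' p = cuspCoeff f p := by
    intro p hp hpd
    have hp3 : p ≠ 3 := fun h ↦ hpd (h ▸ ⟨N₀ * T₀, by ring⟩)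
    have hpN₀ : ¬ p ∣ N₀ * 3 := fun h ↦ hpd (h.trans ⟨T₀, by ring⟩)
    have hpT : ¬ p ∣ T₀ := fun h ↦ hpd (h.trans ⟨3 * N₀, by ring⟩)
    have h1 : cuspCoeff g₁' p = cuspCoeff g₁ p := by
      rw [cuspCoeff, cuspCoeff, ← hlift, coe_liftToGamma1_holds N₁ 2 g₁']
    rw [h1, hcoef p hp hpN₀, hpk p hp hpT, ← mul_assoc, psiThree_sq_natCast hp hp3, one_mul]
  -- strong multiplicity one across levels on `Γ₀`
  have hfin : {p : ℕ | p.Prime ∧ heckeEigenvalue f p ≠ heckeEigenvalue g₁' p}.Finite := by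
    refine (Finset.finite_toSet (3 * N₀ * T₀).divisors).subset ?_
    rintro p ⟨hp, hne⟩
    rw [Finset.mem_coe, Nat.mem_divisors]
    refine ⟨?_, mul_ne_zero (mul_ne_zero three_ne_zero (NeZero.ne N₀)) hT₀⟩
    by_contra hpd
    exact hne (by rw [heckeEigenvalue_eq_cuspCoeff_of_isNewform0 hf hp,
      heckeEigenvalue_eq_cuspCoeff_of_isNewform0 hg₁' hp, hpacket p hp hpd])
  have hNN₁ : N = N₁ := IsNewform0.level_eq_of_heckeEigenvalue_eq_holds hf hg₁' hfin
  -- `27 ∣ N = N₁ ∣ 9 N₀`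
  have h27' : 27 ∣ N₀ * 3 ^ 2 := h27.trans (hNN₁ ▸ hN₁)
  have h : 3 * 9 ∣ N₀ * 9 := by simpa [mul_comm] using h27'
  exact Nat.dvd_of_mul_dvd_mul_right (by norm_num : 0 < 9) h

/-! ### §3 The conductor at `3` and `a₃` on a `ClassO6` row -/

section Curve

variable (W : WeierstrassCurve ℚ) [W.IsElliptic]

/-- **On a `ClassO6` row `27 ∣ N_W`**: the Kodaira type at `3` is wild (`II`, `IV`, `IV*`, `II*`; tree
`subW_three_iff_kodairaSymbolAt_wild`), so `f₃ ≥ 3` (`three_le_condExp_three_of_kodairaSymbolAt_wild`, Ogg's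
formula) and `N_W = ∏ p^{f_p}` (`factorization_conductorNorm_primesEquiv_symm`).
[cite: SilvermanATAEC1994, IV.10.4 and Table 4.1] -/
theorem pow_three_dvd_conductorNorm_of_classO6 (hO6 : ClassO6 W 3) : 3 ^ 3 ∣ W.conductorNorm ℤ := by
  haveI : Fact (Nat.Prime 3) := ⟨Nat.prime_three⟩
  have hwild := (subW_three_iff_kodairaSymbolAt_wild W hO6.2.1).mp hO6.2.2
  have h3 : 3 ≤ condExp W 3 := three_le_condExp_three_of_kodairaSymbolAt_wild W hwild
  have hN0 : W.conductorNorm ℤ ≠ 0 := (W.conductorNorm_pos_holds).ne'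
  rw [Nat.prime_three.pow_dvd_iff_le_factorization hN0]
  have hfac := W.factorization_conductorNorm_primesEquiv_symm ⟨3, Nat.prime_three⟩
  rw [show ((⟨3, Nat.prime_three⟩ : Nat.Primes) : ℕ) = 3 from rfl] at hfac
  rw [hfac]
  exact h3

/-- **On a `ClassO6` row `a₃(W) = 0`** (additive reduction at `3`: the Euler factor is `1`).
[cite: SilvermanAEC2009, §C.16] -/
theorem lFunction_three_eq_zero_of_classO6 (hO6 : ClassO6 W 3) : W.LFunction 3 = 0 := by
  haveI : Fact (Nat.Prime 3) := ⟨Nat.prime_three⟩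
  exact W.LFunction_apply_eq_zero_of_hasAdditiveReductionAt
    (v := (Rat.HeightOneSpectrum.primesEquiv (R := 𝓞 ℚ)).symm ⟨3, Nat.prime_three⟩) (by simp)
    (hasAdditiveReductionAt_of_addv W 3 hO6.2.1) (dvd_refl 3)

end Curve

/-! ### §4 Packets for the engine: the lift of `f_W` and the newform of its `ψ₃`-twist -/

section Packets

variable {W : WeierstrassCurve ℚ}

/-- The lift of the newform of `W` to `Γ₁(N)` has the Dirichlet coefficients of `L(W, s)`. [folklore] -/
theorem cuspCoeff_liftToGamma1_eq_lFunction {N : ℕ} [NeZero N] {f : CuspForm (Gamma0 N) 2}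
    (hf : IsNewformOf W f) (n : ℕ) : cuspCoeff (liftToGamma1 N 2 f) n = (W.LFunction n : ℂ) := by
  rw [← hf.2 n, cuspCoeff, cuspCoeff, coe_liftToGamma1_holds N 2 f]

/-- The newform of `W` is non-zero (`a₁ = 1`). [folklore] -/
theorem ne_zero_of_isNewformOf {N : ℕ} [NeZero N] {f : CuspForm (Gamma0 N) 2} (hf : IsNewformOf W f) :
    f ≠ 0 := by
  intro h0
  have h1 : IsNormalized f := hf.1.2.2
  rw [IsNormalized, h0, CuspForm.coe_zero, UpperHalfPlane.qExpansion_zero, map_zero] at h1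
  exact zero_ne_one h1

/-- **Packet of the lift of `f_W`** in the engine's shape (trivial twist): `a_p = 1 · a_p(W)` and
`ε(p) = 1 = 1²` for every prime `p ∤ N`. [folklore] -/
theorem packet_liftToGamma1 {N : ℕ} [NeZero N] {f : CuspForm (Gamma0 N) 2} (hf : IsNewformOf W f) :
    ∀ p : ℕ, p.Prime → ¬ p ∣ N →
      cuspCoeff (liftToGamma1 N 2 f) p = (fun _ : ℕ ↦ (1 : ℂ)) p * (W.LFunction p : ℂ) ∧
        (nebentypus (liftToGamma1 N 2 f) (p : ZMod N) : ℂ) = (fun _ : ℕ ↦ (1 : ℂ)) p ^ 2 := by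
  intro p hp hpN
  refine ⟨by rw [cuspCoeff_liftToGamma1_eq_lFunction hf, one_mul], ?_⟩
  rw [nebentypus_liftToGamma1_holds N 2 (ne_zero_of_isNewformOf hf), one_pow,
    MulChar.one_apply ((ZMod.isUnit_prime_iff_not_dvd hp).mpr hpN)]

/-- At `3 ∣ N` the (trivial) nebentypus of the lift vanishes at `3`. [folklore] -/
theorem nebentypus_liftToGamma1_apply_three {N : ℕ} [NeZero N] {f : CuspForm (Gamma0 N) 2}
    (hf : IsNewformOf W f) (h3 : 3 ∣ N) : nebentypus (liftToGamma1 N 2 f) ((3 : ℕ) : ZMod N) = 0 := by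
  rw [nebentypus_liftToGamma1_holds N 2 (ne_zero_of_isNewformOf hf)]
  exact MulChar.map_nonunit _ (by rwa [ZMod.isUnit_prime_iff_not_dvd Nat.prime_three, not_not])

/-- **The newform of the `ψ₃`-twist of `f_W`**: a newform `g₀ ∈ S₂(Γ₁(N₀))`, `N₀ ∣ 9N`, with TRIVIAL nebentypus
and the packet `a_p(g₀) = ψ₃(p)a_p(W)`, `ε_{g₀}(p) = ψ₃(p)²` for every prime `p ∤ 3N` (§1 with `ε(lift f) = 1`
and `ψ₃² = 1`). [cite: Shimura1971, Prop. 3.64] [cite: DiamondShurman2005, Thm. 5.8.2–5.8.3] -/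
theorem exists_psiThree_twist_newform {N : ℕ} [NeZero N] {f : CuspForm (Gamma0 N) 2} (hf : IsNewformOf W f) :
    ∃ (N₀ : ℕ) (_ : NeZero N₀) (_ : N₀ ∣ N * 3 ^ 2) (g₀ : CuspForm (Gamma1 N₀) 2), IsNewform1 g₀ ∧
      nebentypus g₀ = 1 ∧
      (∀ p : ℕ, p.Prime → ¬ p ∣ N * 3 →
        cuspCoeff g₀ p = (fun n : ℕ ↦ psiThree (n : ZMod 3)) p * (W.LFunction p : ℂ) ∧
          (nebentypus g₀ (p : ZMod N₀) : ℂ) = (fun n : ℕ ↦ psiThree (n : ZMod 3)) p ^ 2) := by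
  haveI : NeZero (3 : ℕ) := ⟨by norm_num⟩
  have hf₁ : IsNewform1 (liftToGamma1 N 2 f) := (isNewform1_liftToGamma1_iff_holds (N := N) (k := 2) f).mpr hf.1
  obtain ⟨N₀, _, hN₀, g₀, hg₀, hcoef, hchar⟩ := exists_isNewform1_twist_changeLevel hf₁ psiThree_isPrimitive
  have hε : nebentypus g₀ = 1 := by
    apply DirichletCharacter.changeLevel_injective hN₀
    rw [hchar, nebentypus_liftToGamma1_holds N 2 (ne_zero_of_isNewformOf hf), DirichletCharacter.changeLevel_one,
      DirichletCharacter.changeLevel_one, one_mul, ← map_pow, psiThree_isQuadratic.sq_eq_one,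
      DirichletCharacter.changeLevel_one]
  refine ⟨N₀, inferInstance, hN₀, g₀, hg₀, hε, fun p hp hpN ↦ ⟨?_, ?_⟩⟩
  · rw [hcoef p hp hpN, cuspCoeff_liftToGamma1_eq_lFunction hf]
  · have hp3 : p ≠ 3 := fun h ↦ hpN (h ▸ dvd_mul_left 3 N)
    have hpN₀ : ¬ p ∣ N₀ := fun h ↦ hpN (by
      have h' : p ∣ N * 3 ^ 2 := h.trans hN₀
      rcases (Nat.Prime.dvd_mul hp).1 h' with h'' | h''
      · exact h''.mul_right 3
      · exact absurd ((Nat.prime_dvd_prime_iff_eq hp Nat.prime_three).mp (Nat.Prime.dvd_of_dvd_pow hp h'')) hp3)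
    simp only
    rw [hε, MulChar.one_apply ((ZMod.isUnit_prime_iff_not_dvd hp).mpr hpN₀), sq, psiThree_sq_natCast hp hp3]

/-- For a form with trivial nebentypus of level `N₀`: `ε(3) ≠ 0` forces `3 ∤ N₀`. [folklore] -/
theorem not_three_dvd_of_nebentypus_one_apply_ne_zero {N₀ : ℕ} [NeZero N₀] {g₀ : CuspForm (Gamma1 N₀) 2}
    (hε : nebentypus g₀ = 1) (h : (nebentypus g₀ ((3 : ℕ) : ZMod N₀) : ℂ) ≠ 0) : ¬ 3 ∣ N₀ := by
  intro h3
  apply h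
  rw [hε]
  exact MulChar.map_nonunit _ (by rwa [ZMod.isUnit_prime_iff_not_dvd Nat.prime_three, not_not])

end Packets

end Summit.BirchSwinnertonDyer.BirchSwinnertonDyer.Theorems.InertiaWildAtThreeLevel

end
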